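import Mathlib
import Summits.Ventures.PercRepro2.HCov
import Summits.Ventures.PercRepro2.HCovSwap

/-!
# The cross term (J1) at the coincidences `b = o` and `b = a₃` — the 9-cell table, the certificates
(blind cell PercRepro2, mine-a g10 — MINE-A.md §53.9; kit j229416, the LP certificates on the 9-cell
`(o, a₃)` type table; the BHK instances and the two theorems are in `J1Coinc.lean`)

Under `Q = {a₁ ↮ a₂}` (`avoidAll a₂ {a₁}`) write the nine cell masses of the marks `o, a₃`
(`L` = in `C₁`, `H` = in `C₂`, `N` = in neither):
`m0 = P(Q, oL, a₃L)`, `m1 = P(Q, oL, a₃H)`, `m2 = P(Q, oL, a₃N)`, `m3 = P(Q, oH, a₃L)`, `m4 = P(Q, oH, a₃H)`,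
`m5 = P(Q, oH, a₃N)`, `m6 = P(Q, oN, a₃L)`, `m7 = P(Q, oN, a₃H)`, `m8 = P(Q, oN, a₃N)`; `D = m2 + m5 + m8`,
`D_o = m2 + m5`, `γ = D_o / D`, `H = σ₃ (γ − 1[o ∈ U, o ↮ a₃])`.  The lead's cross term with `b := o`
resp. `b := a₃` reads `Cov_μ(σ_o, H) ≥ 0` resp. `Cov_μ(σ₃, H) ≥ 0`; cleared by `P(Q)² · D` these are the
cubic polynomials `covJo`, `covJ3` in the nine masses (`covJo_core`, `covJ3_core` — the LP certificates:
each is a nonnegative combination of cell masses times instances of BHK06 Thm 1.2 / 1.4 with set avoidance,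
plus nonnegative monomials).  The instances are the tree theorems `bhk_same_cluster_events` and
`bhk_cross_cluster_avoid`, evaluated on the cells (`inst_*`).  Since a pendant `b` at `y` gives
`σ_b = 1[f open] · σ_y`, hence `Cov_μ(σ_b, H) = p_f · Cov_μ(σ_y, H)`, these are (J1) at every pendant
`b` attached to `o` or to `a₃` (at a root the covariance vanishes).
-/

namespace Summit.Ventures.PercRepro2

open UnionCluster

namespace J1Coinc

section Core

variable {R : Type*} [Field R] [LinearOrder R] [IsStrictOrderedRing R]

/-- **The certificate for `b = o`** (kit j229416, `covJo:o3:full:1`): `covJo = Σ_k m_k · g_k + monomials`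
with the four instances `g0` (BHK 1.2, root `a₁`), `g1` (BHK 1.4, root `a₁`, avoided `{a₂, a₃}`), `g2`, `g3`
(their `a₁ ↔ a₂` mirrors). -/
theorem covJo_core (m0 m1 m2 m3 m4 m5 m6 m7 m8 : R) (h0 : 0 ≤ m0) (h1 : 0 ≤ m1) (h2 : 0 ≤ m2) (h3 : 0 ≤ m3)
    (h4 : 0 ≤ m4) (h5 : 0 ≤ m5) (h6 : 0 ≤ m6) (h7 : 0 ≤ m7) (h8 : 0 ≤ m8)
    (hg0 : 0 ≤ m0 * m4 + m0 * m5 + m0 * m7 + m0 * m8 - m1 * m3 - m1 * m6 - m2 * m3 - m2 * m6)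
    (hg1 : 0 ≤ -(m1 * m8) + m2 * m4 + m2 * m5 + m2 * m7)
    (hg2 : 0 ≤ m0 * m4 - m1 * m3 - m1 * m5 + m2 * m4 - m3 * m7 + m4 * m6 + m4 * m8 - m5 * m7)
    (hg3 : 0 ≤ m0 * m5 + m2 * m5 - m3 * m8 + m5 * m6) :
    0 ≤ 2 * m0 * m2 * m3 + 4 * m0 * m2 * m4 + 2 * m0 * m2 * m5 + 2 * m0 * m2 * m7 + m0 * m2 * m8 +
      2 * m0 * m3 * m5 + 2 * m0 * m3 * m8 + 4 * m0 * m4 * m5 + 2 * m0 * m5 * m5 + 2 * m0 * m5 * m7 +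
      m0 * m5 * m8 + 2 * m1 * m2 * m4 - m1 * m2 * m6 + m1 * m2 * m7 + 4 * m1 * m3 * m8 +
      2 * m1 * m4 * m5 + 2 * m1 * m4 * m8 - m1 * m5 * m6 + m1 * m5 * m7 + 2 * m1 * m5 * m8 +
      m1 * m6 * m8 + m1 * m7 * m8 + m1 * m8 * m8 + 2 * m2 * m2 * m4 - m2 * m2 * m6 + m2 * m2 * m7 +
      m2 * m3 * m6 - m2 * m3 * m7 + 2 * m2 * m3 * m8 + 2 * m2 * m4 * m5 + 2 * m2 * m4 * m6 +
      m2 * m4 * m8 + m3 * m5 * m6 - m3 * m5 * m7 + m3 * m6 * m8 + m3 * m7 * m8 + m3 * m8 * m8 +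
      2 * m4 * m5 * m6 + m4 * m5 * m8 + m5 * m5 * m6 - m5 * m5 * m7 := by
  linarith [mul_nonneg h2 hg0, mul_nonneg h5 hg0, mul_nonneg h0 hg1, mul_nonneg h1 hg1,
    mul_nonneg h2 hg2, mul_nonneg h5 hg2, mul_nonneg h3 hg3, mul_nonneg h4 hg3,
    mul_nonneg (mul_nonneg h0 h1) h8, mul_nonneg (mul_nonneg h0 h2) h3, mul_nonneg (mul_nonneg h0 h2) h4,
    mul_nonneg (mul_nonneg h0 h3) h5, mul_nonneg (mul_nonneg h0 h3) h8, mul_nonneg (mul_nonneg h0 h4) h5,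
    mul_nonneg (mul_nonneg h0 h5) h5, mul_nonneg (mul_nonneg h0 h5) h7, mul_nonneg (mul_nonneg h1 h1) h8,
    mul_nonneg (mul_nonneg h1 h2) h3, mul_nonneg (mul_nonneg h1 h2) h4, mul_nonneg (mul_nonneg h1 h3) h5,
    mul_nonneg (mul_nonneg h1 h3) h8, mul_nonneg (mul_nonneg h1 h4) h5, mul_nonneg (mul_nonneg h1 h4) h8,
    mul_nonneg (mul_nonneg h1 h5) h5, mul_nonneg (mul_nonneg h1 h5) h7, mul_nonneg (mul_nonneg h1 h5) h8,
    mul_nonneg (mul_nonneg h1 h6) h8, mul_nonneg (mul_nonneg h1 h7) h8, mul_nonneg (mul_nonneg h1 h8) h8,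
    mul_nonneg (mul_nonneg h2 h2) h3, mul_nonneg (mul_nonneg h2 h2) h4, mul_nonneg (mul_nonneg h2 h2) h7,
    mul_nonneg (mul_nonneg h2 h3) h6, mul_nonneg (mul_nonneg h2 h3) h8, mul_nonneg (mul_nonneg h2 h4) h6,
    mul_nonneg (mul_nonneg h2 h5) h6, mul_nonneg (mul_nonneg h2 h5) h7, mul_nonneg (mul_nonneg h3 h3) h8,
    mul_nonneg (mul_nonneg h3 h4) h8, mul_nonneg (mul_nonneg h3 h6) h8, mul_nonneg (mul_nonneg h3 h7) h8,
    mul_nonneg (mul_nonneg h3 h8) h8, mul_nonneg (mul_nonneg h5 h5) h6]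

/-- **The certificate for `b = a₃`** (kit j229416, `covJ3:o3:full:1`): six BHK 1.4 instances
(`g0`, `g1` with the avoided set `{a₂, a₃}`; `g2`, `g3` with `{a₂}` only; `g4`, `g5` mirrors). -/
theorem covJ3_core (m0 m1 m2 m3 m4 m5 m6 m7 m8 : R) (h0 : 0 ≤ m0) (h1 : 0 ≤ m1) (h2 : 0 ≤ m2) (h3 : 0 ≤ m3)
    (h4 : 0 ≤ m4) (h5 : 0 ≤ m5) (h6 : 0 ≤ m6) (h7 : 0 ≤ m7) (h8 : 0 ≤ m8)
    (hg0 : 0 ≤ -(m1 * m5) - m1 * m8 + m2 * m4 + m2 * m7)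
    (hg1 : 0 ≤ -(m1 * m8) + m2 * m4 + m2 * m5 + m2 * m7)
    (hg2 : 0 ≤ m0 * m1 + m0 * m4 + m0 * m5 + m0 * m7 + m1 * m6 - m2 * m3 - m3 * m8 + m4 * m6 + m5 * m6 +
      m6 * m7)
    (hg3 : 0 ≤ m0 * m4 + m0 * m7 - m1 * m5 - m1 * m8 + m2 * m4 + m2 * m7 + m3 * m4 + m3 * m7 + m4 * m6 +
      m6 * m7)
    (hg4 : 0 ≤ m0 * m5 - m2 * m3 - m3 * m8 + m5 * m6)
    (hg5 : 0 ≤ m0 * m5 + m2 * m5 - m3 * m8 + m5 * m6) :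
    0 ≤ 2 * m0 * m1 * m2 + 2 * m0 * m1 * m5 - 2 * m0 * m1 * m8 + m0 * m2 * m2 + 4 * m0 * m2 * m4 +
      2 * m0 * m2 * m5 + 4 * m0 * m2 * m7 + m0 * m2 * m8 + 4 * m0 * m4 * m5 + m0 * m5 * m5 +
      4 * m0 * m5 * m7 + m0 * m5 * m8 + 2 * m1 * m2 * m6 - m1 * m2 * m8 - 4 * m1 * m3 * m8 +
      2 * m1 * m5 * m6 - m1 * m5 * m8 - 2 * m1 * m6 * m8 - m1 * m8 * m8 + m2 * m2 * m4 + m2 * m2 * m6 +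
      m2 * m2 * m7 + 2 * m2 * m3 * m4 + 2 * m2 * m3 * m7 - m2 * m3 * m8 + 2 * m2 * m4 * m5 +
      4 * m2 * m4 * m6 + m2 * m4 * m8 + 2 * m2 * m5 * m6 + 2 * m2 * m5 * m7 + 4 * m2 * m6 * m7 +
      m2 * m6 * m8 + m2 * m7 * m8 + 2 * m3 * m4 * m5 - 2 * m3 * m4 * m8 + 2 * m3 * m5 * m7 -
      m3 * m5 * m8 - 2 * m3 * m7 * m8 - m3 * m8 * m8 + m4 * m5 * m5 + 4 * m4 * m5 * m6 + m4 * m5 * m8 +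
      m5 * m5 * m6 + m5 * m5 * m7 + 4 * m5 * m6 * m7 + m5 * m6 * m8 + m5 * m7 * m8 := by
  linarith [mul_nonneg h0 hg0, mul_nonneg h3 hg0, mul_nonneg h6 hg0, mul_nonneg h8 hg0,
    mul_nonneg h0 hg1, mul_nonneg h3 hg1, mul_nonneg h6 hg1, mul_nonneg h2 hg2, mul_nonneg h5 hg2,
    mul_nonneg h2 hg3, mul_nonneg h5 hg3, mul_nonneg h1 hg4, mul_nonneg h4 hg4, mul_nonneg h7 hg4,
    mul_nonneg h8 hg4, mul_nonneg h1 hg5, mul_nonneg h4 hg5, mul_nonneg h7 hg5,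
    mul_nonneg (mul_nonneg h0 h1) h2, mul_nonneg (mul_nonneg h0 h2) h2, mul_nonneg (mul_nonneg h0 h2) h8,
    mul_nonneg (mul_nonneg h1 h2) h3, mul_nonneg (mul_nonneg h1 h2) h6, mul_nonneg (mul_nonneg h1 h3) h5,
    mul_nonneg (mul_nonneg h1 h5) h5, mul_nonneg (mul_nonneg h1 h5) h8, mul_nonneg (mul_nonneg h2 h2) h3,
    mul_nonneg (mul_nonneg h2 h2) h6, mul_nonneg (mul_nonneg h2 h3) h8, mul_nonneg (mul_nonneg h2 h6) h8,
    mul_nonneg (mul_nonneg h3 h4) h5, mul_nonneg (mul_nonneg h3 h5) h7, mul_nonneg (mul_nonneg h4 h5) h5,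
    mul_nonneg (mul_nonneg h4 h5) h8, mul_nonneg (mul_nonneg h5 h5) h7, mul_nonneg (mul_nonneg h5 h7) h8]

end Core

section Events

variable {V : Type*} {E : Type*} [Fintype E] [DecidableEq E] [Fintype V] [DecidableEq V]
  {R : Type*} [Field R] [LinearOrder R] [IsStrictOrderedRing R]

variable (p : E → R) (ends : E → Sym2 V) (o a₁ a₂ a₃ : V)

local notation3 "Q" => avoidAll ends a₂ {a₁}
local notation3 "oL" => connEvent ends a₁ o
local notation3 "oH" => connEvent ends a₂ o
local notation3 "oN" => (connEvent ends a₁ o)ᶜ ∩ (connEvent ends a₂ o)ᶜ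
local notation3 "tL" => connEvent ends a₁ a₃
local notation3 "tH" => connEvent ends a₂ a₃
local notation3 "tN" => (connEvent ends a₁ a₃)ᶜ ∩ (connEvent ends a₂ a₃)ᶜ

omit [Fintype E] [DecidableEq E] [Fintype V] [DecidableEq V] in
/-- Under `Q`, a vertex cannot lie in both clusters. -/
lemma not_both {ω : Config E} (hQ : ω ∈ Q) {v : V} (h1 : Conn ends ω a₁ v) (h2 : Conn ends ω a₂ v) :
    False := by
  have : ¬ Conn ends ω a₂ a₁ := by simpa [mem_avoidAll] using hQ
  exact this (conn_trans h2 (conn_symm h1))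

omit [Fintype V] [DecidableEq V] in
/-- **Split by the position of `o`**: `P(Q ∩ A) = P(Q ∩ oL ∩ A) + P(Q ∩ oH ∩ A) + P(Q ∩ oN ∩ A)`. -/
lemma splitO (A : Set (Config E)) :
    prob p (Q ∩ A) = prob p (Q ∩ oL ∩ A) + prob p (Q ∩ oH ∩ A) + prob p (Q ∩ oN ∩ A) := by
  have h1 := prob_inter_add_prob_inter_compl p (Q ∩ A) oL
  have h2 := prob_inter_add_prob_inter_compl p (Q ∩ A ∩ oLᶜ) oH
  have e1 : Q ∩ A ∩ oL = Q ∩ oL ∩ A := by ext ω; simp only [Set.mem_inter_iff]; tauto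
  have e2 : Q ∩ A ∩ oLᶜ ∩ oH = Q ∩ oH ∩ A := by
    ext ω
    simp only [Set.mem_inter_iff, Set.mem_compl_iff, mem_connEvent]
    constructor
    · rintro ⟨⟨⟨hQ, hA⟩, _⟩, hH⟩; exact ⟨⟨hQ, hH⟩, hA⟩
    · rintro ⟨⟨hQ, hH⟩, hA⟩; exact ⟨⟨⟨hQ, hA⟩, fun hL => not_both ends a₁ a₂ hQ hL hH⟩, hH⟩
  have e3 : Q ∩ A ∩ oLᶜ ∩ oHᶜ = Q ∩ oN ∩ A := by
    ext ω; simp only [Set.mem_inter_iff, Set.mem_compl_iff]; tauto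
  rw [e1] at h1; rw [e2, e3] at h2; linarith

omit [Fintype V] [DecidableEq V] in
/-- **Split by the position of `a₃`**: `P(Q ∩ A) = P(Q ∩ A ∩ tL) + P(Q ∩ A ∩ tH) + P(Q ∩ A ∩ tN)`. -/
lemma split3 (A : Set (Config E)) :
    prob p (Q ∩ A) = prob p (Q ∩ A ∩ tL) + prob p (Q ∩ A ∩ tH) + prob p (Q ∩ A ∩ tN) := by
  have h1 := prob_inter_add_prob_inter_compl p (Q ∩ A) tL
  have h2 := prob_inter_add_prob_inter_compl p (Q ∩ A ∩ tLᶜ) tH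
  have e2 : Q ∩ A ∩ tLᶜ ∩ tH = Q ∩ A ∩ tH := by
    ext ω
    simp only [Set.mem_inter_iff, Set.mem_compl_iff, mem_connEvent]
    constructor
    · rintro ⟨⟨hQA, _⟩, hH⟩; exact ⟨hQA, hH⟩
    · rintro ⟨hQA, hH⟩; exact ⟨⟨hQA, fun hL => not_both ends a₁ a₂ hQA.1 hL hH⟩, hH⟩
  have e3 : Q ∩ A ∩ tLᶜ ∩ tHᶜ = Q ∩ A ∩ tN := by
    ext ω; simp only [Set.mem_inter_iff, Set.mem_compl_iff]; tauto
  rw [e2, e3] at h2; linarith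

omit [Fintype E] [DecidableEq E] [Fintype V] [DecidableEq V] in
/-- `{a₁ ↮ a₂}` as `Q`. -/
lemma Qc_eq : (connEvent ends a₁ a₂)ᶜ = Q := by
  ext ω
  simp only [Set.mem_compl_iff, mem_connEvent, mem_avoidAll, Finset.mem_singleton, forall_eq]
  exact ⟨fun h hc => h (conn_symm hc), fun h hc => h (conn_symm hc)⟩

omit [Fintype E] [DecidableEq E] [Fintype V] [DecidableEq V] in
/-- `{a₂ ↮ a₁}` as `Q`. -/
lemma Qc'_eq : (connEvent ends a₂ a₁)ᶜ = Q := by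
  ext ω
  simp only [Set.mem_compl_iff, mem_connEvent, mem_avoidAll, Finset.mem_singleton, forall_eq]

omit [Fintype E] [DecidableEq E] [Fintype V] in
/-- `{a₁ ↮ a₂, a₁ ↮ a₃} = Q ∩ tLᶜ`. -/
lemma R_eq : avoidAll ends a₁ {a₂, a₃} = Q ∩ tLᶜ := by
  ext ω
  simp only [mem_avoidAll, Finset.mem_insert, Finset.mem_singleton, forall_eq_or_imp, forall_eq,
    Set.mem_inter_iff, Set.mem_compl_iff, mem_connEvent]
  exact ⟨fun ⟨h1, h2⟩ => ⟨fun hc => h1 (conn_symm hc), h2⟩, fun ⟨h1, h2⟩ => ⟨fun hc => h1 (conn_symm hc), h2⟩⟩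

omit [Fintype E] [DecidableEq E] [Fintype V] in
/-- `{a₂ ↮ a₁, a₂ ↮ a₃} = Q ∩ tHᶜ`. -/
lemma R'_eq : avoidAll ends a₂ {a₁, a₃} = Q ∩ tHᶜ := by
  ext ω
  simp only [mem_avoidAll, Finset.mem_insert, Finset.mem_singleton, forall_eq_or_imp, forall_eq,
    Set.mem_inter_iff, Set.mem_compl_iff, mem_connEvent]

omit [Fintype E] [DecidableEq E] [Fintype V] [DecidableEq V] in
/-- The cluster event of a union of two «contains» families is the union of the connection events. -/
lemma cI_union (x u v : V) :
    clusterInEvent ends x ({W : Set V | u ∈ W} ∪ {W : Set V | v ∈ W}) =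
      connEvent ends x u ∪ connEvent ends x v := by
  ext ω
  simp only [mem_clusterInEvent, Set.mem_union, Set.mem_setOf_eq, mem_connEvent]
  rfl

/-! ### The aggregates as sums of cells -/

omit [Fintype V] [DecidableEq V] in
/-- `P(Q)` as the sum of the nine cells. -/
lemma hZ : prob p Q = prob p (Q ∩ oL ∩ tL) + prob p (Q ∩ oL ∩ tH) + prob p (Q ∩ oL ∩ tN) +
    (prob p (Q ∩ oH ∩ tL) + prob p (Q ∩ oH ∩ tH) + prob p (Q ∩ oH ∩ tN)) +
    (prob p (Q ∩ oN ∩ tL) + prob p (Q ∩ oN ∩ tH) + prob p (Q ∩ oN ∩ tN)) := by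
  have h := splitO p ends o a₁ a₂ Set.univ
  simp only [Set.inter_univ] at h
  rw [h, split3 p ends a₁ a₂ a₃ oL, split3 p ends a₁ a₂ a₃ oH, split3 p ends a₁ a₂ a₃ oN]

omit [Fintype V] [DecidableEq V] in
/-- `P(Q ∩ tLᶜ) = P(Q) − P(Q ∩ tL)`. -/
lemma hR : prob p (Q ∩ tLᶜ) = prob p Q - prob p (Q ∩ tL) := by
  have := prob_inter_add_prob_inter_compl p Q tL; linarith

omit [Fintype V] [DecidableEq V] in
/-- `P(Q ∩ tHᶜ) = P(Q) − P(Q ∩ tH)`. -/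
lemma hR' : prob p (Q ∩ tHᶜ) = prob p Q - prob p (Q ∩ tH) := by
  have := prob_inter_add_prob_inter_compl p Q tH; linarith

omit [Fintype V] [DecidableEq V] in
/-- `P(Q ∩ oL ∩ tLᶜ) = P(Q ∩ oL) − P(Q ∩ oL ∩ tL)`. -/
lemma hoLtLc : prob p (Q ∩ oL ∩ tLᶜ) = prob p (Q ∩ oL) - prob p (Q ∩ oL ∩ tL) := by
  have := prob_inter_add_prob_inter_compl p (Q ∩ oL) tL; linarith

omit [Fintype V] [DecidableEq V] in
/-- `P(Q ∩ oH ∩ tHᶜ) = P(Q ∩ oH) − P(Q ∩ oH ∩ tH)`. -/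
lemma hoHtHc : prob p (Q ∩ oH ∩ tHᶜ) = prob p (Q ∩ oH) - prob p (Q ∩ oH ∩ tH) := by
  have := prob_inter_add_prob_inter_compl p (Q ∩ oH) tH; linarith

omit [Fintype E] [DecidableEq E] [Fintype V] [DecidableEq V] in
/-- `(tH ∪ oH) ∩ (Q ∩ tLᶜ) = (Q ∩ tH) ⊔ (Q ∩ oH ∩ tN)`. -/
lemma U1_eq : (tH ∪ oH) ∩ (Q ∩ tLᶜ) = (Q ∩ tH) ∪ (Q ∩ oH ∩ tN) := by
  ext ω
  simp only [Set.mem_inter_iff, Set.mem_union, Set.mem_compl_iff, mem_connEvent]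
  constructor
  · rintro ⟨h, hQ, hL⟩
    rcases h with hH | hoH
    · exact Or.inl ⟨hQ, hH⟩
    · by_cases hH : Conn ends ω a₂ a₃
      · exact Or.inl ⟨hQ, hH⟩
      · exact Or.inr ⟨⟨hQ, hoH⟩, hL, hH⟩
  · rintro (⟨hQ, hH⟩ | ⟨⟨hQ, hoH⟩, hL, _⟩)
    · exact ⟨Or.inl hH, hQ, fun hL => not_both ends a₁ a₂ hQ hL hH⟩
    · exact ⟨Or.inr hoH, hQ, hL⟩

omit [Fintype E] [DecidableEq E] [Fintype V] [DecidableEq V] in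
/-- `(tL ∪ oL) ∩ (Q ∩ tHᶜ) = (Q ∩ tL) ⊔ (Q ∩ oL ∩ tN)`. -/
lemma U2_eq : (tL ∪ oL) ∩ (Q ∩ tHᶜ) = (Q ∩ tL) ∪ (Q ∩ oL ∩ tN) := by
  ext ω
  simp only [Set.mem_inter_iff, Set.mem_union, Set.mem_compl_iff, mem_connEvent]
  constructor
  · rintro ⟨h, hQ, hH⟩
    rcases h with hL | hoL
    · exact Or.inl ⟨hQ, hL⟩
    · by_cases hL : Conn ends ω a₁ a₃
      · exact Or.inl ⟨hQ, hL⟩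
      · exact Or.inr ⟨⟨hQ, hoL⟩, hL, hH⟩
  · rintro (⟨hQ, hL⟩ | ⟨⟨hQ, hoL⟩, _, hH⟩)
    · exact ⟨Or.inl hL, hQ, fun hH => not_both ends a₁ a₂ hQ hL hH⟩
    · exact ⟨Or.inr hoL, hQ, hH⟩

omit [Fintype E] [DecidableEq E] [Fintype V] [DecidableEq V] in
/-- `(tH ∪ oH) ∩ Q = (Q ∩ tH) ⊔ (Q ∩ oH ∩ tHᶜ)`. -/
lemma U3_eq : (tH ∪ oH) ∩ Q = (Q ∩ tH) ∪ (Q ∩ oH ∩ tHᶜ) := by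
  ext ω
  simp only [Set.mem_inter_iff, Set.mem_union, Set.mem_compl_iff, mem_connEvent]
  constructor
  · rintro ⟨h, hQ⟩
    rcases h with hH | hoH
    · exact Or.inl ⟨hQ, hH⟩
    · by_cases hH : Conn ends ω a₂ a₃
      · exact Or.inl ⟨hQ, hH⟩
      · exact Or.inr ⟨⟨hQ, hoH⟩, hH⟩
  · rintro (⟨hQ, hH⟩ | ⟨⟨hQ, hoH⟩, _⟩)
    · exact ⟨Or.inl hH, hQ⟩
    · exact ⟨Or.inr hoH, hQ⟩

omit [Fintype E] [DecidableEq E] [Fintype V] [DecidableEq V] in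
/-- `(tL ∪ oL) ∩ Q = (Q ∩ tL) ⊔ (Q ∩ oL ∩ tLᶜ)`. -/
lemma U4_eq : (tL ∪ oL) ∩ Q = (Q ∩ tL) ∪ (Q ∩ oL ∩ tLᶜ) := by
  ext ω
  simp only [Set.mem_inter_iff, Set.mem_union, Set.mem_compl_iff, mem_connEvent]
  constructor
  · rintro ⟨h, hQ⟩
    rcases h with hL | hoL
    · exact Or.inl ⟨hQ, hL⟩
    · by_cases hL : Conn ends ω a₁ a₃
      · exact Or.inl ⟨hQ, hL⟩
      · exact Or.inr ⟨⟨hQ, hoL⟩, hL⟩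
  · rintro (⟨hQ, hL⟩ | ⟨⟨hQ, hoL⟩, _⟩)
    · exact ⟨Or.inl hL, hQ⟩
    · exact ⟨Or.inr hoL, hQ⟩

omit [Fintype V] [DecidableEq V] [LinearOrder R] [IsStrictOrderedRing R] in
/-- `P((tH ∪ oH) ∩ (Q ∩ tLᶜ)) = P(Q ∩ tH) + P(Q ∩ oH ∩ tN)`. -/
lemma hU1 : prob p ((tH ∪ oH) ∩ (Q ∩ tLᶜ)) = prob p (Q ∩ tH) + prob p (Q ∩ oH ∩ tN) := by
  rw [U1_eq]
  refine prob_union_of_disjoint p ?_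
  rw [Set.disjoint_left]
  rintro ω ⟨_, hH⟩ ⟨_, _, hH'⟩
  exact hH' hH

omit [Fintype V] [DecidableEq V] [LinearOrder R] [IsStrictOrderedRing R] in
/-- `P((tL ∪ oL) ∩ (Q ∩ tHᶜ)) = P(Q ∩ tL) + P(Q ∩ oL ∩ tN)`. -/
lemma hU2 : prob p ((tL ∪ oL) ∩ (Q ∩ tHᶜ)) = prob p (Q ∩ tL) + prob p (Q ∩ oL ∩ tN) := by
  rw [U2_eq]
  refine prob_union_of_disjoint p ?_
  rw [Set.disjoint_left]
  rintro ω ⟨_, hL⟩ ⟨_, hL', _⟩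
  exact hL' hL

omit [Fintype V] [DecidableEq V] [LinearOrder R] [IsStrictOrderedRing R] in
/-- `P((tH ∪ oH) ∩ Q) = P(Q ∩ tH) + P(Q ∩ oH ∩ tHᶜ)`. -/
lemma hU3 : prob p ((tH ∪ oH) ∩ Q) = prob p (Q ∩ tH) + prob p (Q ∩ oH ∩ tHᶜ) := by
  rw [U3_eq]
  refine prob_union_of_disjoint p ?_
  rw [Set.disjoint_left]
  rintro ω ⟨_, hH⟩ ⟨_, hH'⟩
  exact hH' hH

omit [Fintype V] [DecidableEq V] [LinearOrder R] [IsStrictOrderedRing R] in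
/-- `P((tL ∪ oL) ∩ Q) = P(Q ∩ tL) + P(Q ∩ oL ∩ tLᶜ)`. -/
lemma hU4 : prob p ((tL ∪ oL) ∩ Q) = prob p (Q ∩ tL) + prob p (Q ∩ oL ∩ tLᶜ) := by
  rw [U4_eq]
  refine prob_union_of_disjoint p ?_
  rw [Set.disjoint_left]
  rintro ω ⟨_, hL⟩ ⟨_, hL'⟩
  exact hL' hL

end Events

end J1Coinc

end Summit.Ventures.PercRepro2
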